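import Mathlib

/-!
# Tensoring a linearly independent family with non-zero vectors

Blind re-derivation cell `pub-hodge-repro`, seat `night-3` (gen 2).  Mathlib only.  Namespace `HodgeRepro.Night3.WeilModel`.

The two-factor step of `Night3WeilModelBasis` («the lines of `B_a × B_b` are linearly independent once those of `B_a`
are and those of `B_b` are non-zero») rests on two pieces of linear algebra over a field `L`, proved here as a leaf:

* `linearIndependent_tmul_of_ne_zero` — a linearly independent family `b₁` tensored diagonally with non-zero vectors
  `d₂ i` stays linearly independent (typer-2's candidate `LemmaPProduct.linearIndependent_tmul_of_ne_zero`,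
  f74894530183540a, takes a BASIS of the first factor; here a family, through a separating functional
  `Submodule.exists_dual_map_eq_bot_of_notMem` — the coordinate functional of a basis is replaced by a functional
  vanishing on the span of the other vectors);
* `linearIndependent_equiv_comp` — a linear equivalence preserves linear independence, stated at the `AddCommMonoid`
  level so that it applies to large tensor-product types without any instance rewriting (the Ring-level `map'` /
  `linearIndependent_iff'` time out there on the instance diamond `AddCommGroup.toAddCommMonoid` vs
  `TensorProduct.addCommMonoid`).

Nothing here closes S4; no sealed file is touched; no Tier-2 item depends on this file.
-/

set_option autoImplicit false

open TensorProduct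

namespace HodgeRepro.Night3.WeilModel

section Tensor

variable {L : Type*} [Field L] {V₁ V₂ : Type*} [AddCommGroup V₁] [Module L V₁] [AddCommGroup V₂] [Module L V₂]

/-- A linearly independent family `b₁` tensored diagonally with non-zero vectors `d₂ i` is linearly independent: for each
`j` a functional `f` with `f (b₁ j) ≠ 0` vanishing on the other `b₁ i` (they span a subspace not containing `b₁ j`), and
`(f ⊗ id)` isolates `g j • d₂ j` in a vanishing combination. -/
theorem linearIndependent_tmul_of_ne_zero {ι : Type*} {b₁ : ι → V₁} (hb : LinearIndependent L b₁) (d₂ : ι → V₂)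
    (hd : ∀ i, d₂ i ≠ 0) : LinearIndependent L fun i => b₁ i ⊗ₜ[L] d₂ i := by
  classical
  rw [linearIndependent_iff']
  intro s g hsum j hj
  have hnot : b₁ j ∉ Submodule.span L (b₁ '' {i | i ≠ j}) := hb.notMem_span_image (by simp)
  obtain ⟨f, hfj, hfU⟩ := Submodule.exists_dual_map_eq_bot_of_notMem hnot inferInstance
  have hf0 : ∀ i, i ≠ j → f (b₁ i) = 0 := fun i hi => by
    have : f (b₁ i) ∈ (Submodule.span L (b₁ '' {i | i ≠ j})).map f :=
      Submodule.mem_map_of_mem (Submodule.subset_span ⟨i, hi, rfl⟩)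
    rwa [hfU, Submodule.mem_bot] at this
  have key : TensorProduct.lid L V₂ (LinearMap.rTensor V₂ f (∑ i ∈ s, g i • (b₁ i ⊗ₜ[L] d₂ i))) =
      (g j * f (b₁ j)) • d₂ j := by
    rw [map_sum, map_sum, Finset.sum_eq_single j]
    · rw [map_smul, map_smul, LinearMap.rTensor_tmul, TensorProduct.lid_tmul, smul_smul]
    · intro i _ hij
      rw [map_smul, map_smul, LinearMap.rTensor_tmul, hf0 i hij, TensorProduct.zero_tmul, map_zero, smul_zero]
    · intro h; exact absurd hj h
  rw [hsum, map_zero, map_zero] at key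
  have h1 := (smul_eq_zero.mp key.symm).resolve_right (hd j)
  exact (mul_eq_zero.mp h1).resolve_right hfj

/-- A linear equivalence preserves linear independence (stated at the `AddCommMonoid` level so that it applies to
large tensor-product types without any instance rewriting). -/
theorem linearIndependent_equiv_comp {V V' : Type*} [AddCommMonoid V] [Module L V] [AddCommMonoid V'] [Module L V']
    (e : V ≃ₗ[L] V') {ι : Type*} {v : ι → V} (hv : LinearIndependent L v) : LinearIndependent L (⇑e ∘ v) :=
  hv.map_injOn e.toLinearMap (e.injective.injOn)

end Tensor

end HodgeRepro.Night3.WeilModel
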